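import Literature.NumberTheory.GaloisRepresentations.GoverningFieldOfOpenNormal
import Literature.NumberTheory.GaloisRepresentations.ContinuousH1SahNoFixedVector
import Literature.NumberTheory.GaloisRepresentations.ContinuousH1ResCocycle
import HarnessLib

/-!
# Sah's lemma for an open normal subgroup: non-zero classes are non-zero on `N`

Glue for the `μ`-transfer core of BSD crux 19276 (HOME/koly/MU-TRANSFER-PROOF.md (F8)), in the
field-free spelling consumed by `Summit.….LevelE.valueSubgroup_eq_top_of_towerConst_ne_zero`
(hypothesis `hSah`): for an OPEN normal subgroup `N ≤ Γ_K` (`K` perfect), a finite discrete module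
`M`, and `z ∈ Γ_K` central modulo `N` without non-zero fixed vector on `M`, every continuous
1-cocycle of `M` with non-zero class takes a non-zero value on `N`
(`exists_mem_apply_ne_zero_of_isOpen`): `N = Gal(K̄/L₀)` (`exists_isGalois_absGaloisFixingSubgroup_eq`),
`res : H¹(K, M) → H¹(L₀, M)` is injective (Sah, `res_one_injective_of_forall_fixed_eq_zero`), and
`res` is computed on cocycles (`exists_mem_absGaloisFixingSubgroup_apply_ne_zero`).
-/

noncomputable section

open Field Function

universe u

namespace Literature.NumberTheory.GaloisRepresentations.galoisCohomology

variable {K : Type u} [Field K] [PerfectField K] {M : Type u} [AddCommGroup M] [TopologicalSpace M]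
  [DiscreteTopology M] [Finite M] (ρ : DiscreteGaloisModule K M)

/-- **Sah for an open normal subgroup.** If `N ≤ Γ_K` is open and normal and `z ∈ Γ_K` is central
modulo `N` with no non-zero fixed vector on the finite module `M`, then a continuous 1-cocycle of
`M` whose class in `H¹(K, M)` is non-zero does not vanish on `N`.
[cite: Sah1968, Prop. 2.7 (b)] [cite: NeukirchSchmidtWingberg2008, (1.6.7)] -/
theorem exists_mem_apply_ne_zero_of_isOpen (N : Subgroup (absoluteGaloisGroup K)) [N.Normal]
    (hNo : IsOpen (N : Set (absoluteGaloisGroup K))) {z : absoluteGaloisGroup K}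
    (hzc : (z : absoluteGaloisGroup K ⧸ N) ∈ Subgroup.center (absoluteGaloisGroup K ⧸ N))
    (hz : ∀ m : M, ρ z m = m → m = 0) (φ : contOneCocycles ρ.toTopRep)
    (hφ : oneCocycleClass ρ.toTopRep φ ≠ 0) : ∃ τ ∈ N, φ.1 τ ≠ 0 := by
  obtain ⟨L₀, hL, hfix⟩ := exists_isGalois_absGaloisFixingSubgroup_eq K N hNo
  subst hfix
  haveI := hL
  exact exists_mem_absGaloisFixingSubgroup_apply_ne_zero ρ L₀
    (res_one_injective_of_forall_fixed_eq_zero ρ L₀ hzc hz) φ hφ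

end Literature.NumberTheory.GaloisRepresentations.galoisCohomology

end
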